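import Summits.ABC.IUTFork.Conditional.AbcOfSGenuineKChosenDepth
import Summits.ABC.IUTFork.Conditional.HexDepthRadCore
import Summits.ABC.IUTFork.Cor312LicenceExactRadiusEnvelope
import Summits.ABC.IUTFork.Cor312GenuineKDeepDatumLam
import Summits.ABC.IUTFork.Cor312ProvKRamifiedLabel
import Literature.IUT.LogVolume.InitialThetaDataBadPlaceRamification
import HarnessLib

/-!
# Branch C / R-W «W:HEX-RAD-WRAP» (plan g9 19:01:31Z): the STAR × ENVELOPE-RADIUS engine ([RAD], abc-iut-c312-3 p454852) at the
# GENUINE `K`-datum with the CHOSEN realising ideles, and its HEX composition with abc-iut-W-num-6's RAD-UNIFORM arithmetic core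
# (p462893) under a LOCAL ramification bound `e(K_{x₀}/ℚ_7) ≤ E` — per datum `¬ S_H` from ONE integer criterion per `(k, l)`

PROOF-ONLY file (0 definitions, 0 `Prop` facts, no instance, no notation) of the abc-iut cell (seat abc-iut-W-neg-2, gen 0; D-0079 rescue
sub-cell R-W, lane P−; plan g9 19:01:31Z «W:HEX-RAD-WRAP», first refusal taken 19:1xZ). TAKES NO SIDE on [IUTchIII] Cor. 3.12
(S. Mochizuki, *Inter-universal Teichmüller theory III*, RIMS manuscript, Cor. 3.12 p. 173–174, Step (xi-f) p. 184) or on any author.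

WHY. The [LIN] engine of this seat's `HexDepthLocalType*` files (abc-iut-C-cert-1 p438886 on abc-iut-w5-d107's `(d, a, b)` threshold) charges
the log-shell slot the [IUTchIV] Prop. 1.2 exponent `b = ⌊log₇(7e/6)⌋ − 1/e`, which JUMPS by `1` at `e = 6·7ⁿ`; the exact radius of
`log_7(𝒪^×_{K_{x₀}})` is the ENVELOPE `‖ϖ‖^{7^{a₀} − e·a₀}` (abc-iut-c312-3 `UnitLogMaxNorm` / `Cor312LicenceExactRadiusEnvelope`, `a₀` the
turning point of `e`), i.e. the exponent `a₀ − 7^{a₀}/e`, continuous in `e`. At the genuine Tate type `e ≤ 30·l` (`a₀ = 3` just above `294`)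
this is worth almost a full unit per slot: `(12, 11)` → `(9, 11)` on the HEX table.

* §1 (private helper `HexRad.not_pilotKummerCompatHull_chosen_of_envelope_socket`; the PUBLIC genuine-datum RAD decider in q-degree
  currency is abc-iut-w5-d236's `GenuineK.not_pilotKummerCompatHull_chosen_of_star_envelope`, p463434, landed while this file was being
  written — not restated here, only the raw-socket currency needed by §2 is kept, privately) — abc-iut-c312-3's licence socket
  `Thm311.Real.not_licence_settingPrVolSharp_of_explicitDepth_star_envelope` (p454852) INSTANTIATED at the constructed datum `pilotDataOfK T.D T.K`
  with the CHOSEN realising Θ- and q-ideles and the PINNED reading (the data of the S_H binders `hSH`/`hSHw`): for a prime `p`, a label `i₀+1`,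
  a place `x₀ | p` with `‖t_{Θ,i₀+1,x₀}‖ = p^{−m_Θ/e}`, a norm uniformizer `ϖ`, a turning point `a₀` of `e = e(K_{x₀}/ℚ_p)` and
  `‖p^{n₁}‖·‖ϖ‖^{(p^{a₀} − e·a₀)(i₀+2)} < ‖t_{q,x₀}‖` (`n₁ = ⌊m_Θ/e − (d_I − d) − a_I⌋` at the constant `x₀`-tuple) ⟹
  `¬ Cor312Vol.PilotKummerCompatHull … (fun _ => qRegion) qK` (q-pin by `rfl`, `licence_of_pilotKummerCompatHull`; pattern of p438886).
* §2 `HexRad.not_pilotKummerCompatHull_lamSeven_of_criterion` — at EVERY genuine Θ-volume datum `T` over `(ratPoint λ_k, l)`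
  (`λ_k = 1/2 + 2/7^k`, `k ≥ 1`, `l ≥ 11` prime) whose places `x₀ | 7` have `e(K_{x₀}/ℚ_7) ≤ E`, given a turning index `S` of `E`
  (`7^a·6 < E` for `a < S`, `E ≤ 7^S·6`), an integer `F` with `5l·F ≤ 5j²k − 5jl − (j+1)(l+5)` (`j = (l−1)/2`) and W-num-6's criterion
  `(j+1)·l·(S·E − 7^S) < (F·l − k)·E`: S_H FAILS for every choice of the free binders. Inputs BY NAME: abc-iut-c312-7
  `GenuineK.exists_place_lamSeven` (`x₀ | 7` bad, tame, `‖t_q(x₀)‖ = 7^{−k/l}`), abc-iut-c312-5/w5-d054 `l_le_absRamificationIdx_kOf_pilotDataOfK`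
  and `l_dvd_ramificationIdx'_of_over_VFbad` (`l ∣ e`, so `m_Θ = j²·k·(e/l) ∈ ℤ`), `LogEnvelope.exists_turning`, `isUniformizer_unifChoice`,
  abc-iut-w4-d036's `norm_thetaIdele_eq_pow_of_realises` (`‖t_Θ‖ = ‖t_q‖^{j²}`), `differentOrd_eq_of_not_dvd` (`d = (e−1)/e < 1`), and
  W-num-6's `HexRad.logExponent_lt_floor_of_criterion` (the log form `k/l + (j+1)(a₀ − 7^{a₀}/e) < ⌊j²k/l − j·d − (j+1)·a⌋` of the test).
The `E = 30·l` discharge (abc-iut-W-neg-1 `GenuineK.absRamificationIdx_kOf_le_thirty_mul_lamSeven`) and the decided `(k, l)` table are the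
sequel file `HexDepthRadThirty`.

HONEST SCOPE: SHARP reading; the per-label licence is a STRONGER-THAN-PRINT sufficient form of (xi-f) read at ONE diagonal summand with the
exact per-slot radius (what this socket leaves undecided is undecided BY THAT SOCKET — abc-iut-c312-3's optimality §3); nothing about the
printed GLOBAL inequality, the number-level `Cor22.Cor312AtDatum`, or any author's intended hull; HEX rows are Szpiro-GOOD; no side taken on
any author; typed ≠ proved; refuted-as-typed ≠ refuted-in-print; no abc claim.
[cite: Mochizuki2012, IUTchIII Cor. 3.12 Step (xi-f) p. 184; IUTchIV Prop. 1.1 p. 9, Prop. 1.2 (i)(ii) p. 10, Cor. 2.2 (ii) proof (P5) p. 46]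
[cite: DupuyHilado2025, §3.4, §3.9, §4.9] [cite: NeukirchANT1999, Ch. II (5.5)] [claim: Mochizuki2012, status: disputed] for every IUT quotation.
-/

noncomputable section

open Set Function NumberField IsDedekindDomain

namespace Summit.ABC.IUTFork.Conditional

open Thm311 Thm311.Real Cor312 Cor312Vol Cor312Prov Literature.IUT.LogThetaLattice Literature.IUT.LogVolume
  Literature.IUT.HodgeTheaters Literature.IUT.LogVolume.ThetaData Literature.IUT.LogVolume.LogEnvelope
  Literature.NumberTheory.NumberFields Literature.NumberTheory.GaloisRepresentations.Ultrametric
open Literature.NumberTheory.DiophantineGeometry.GenEll Summit.ABC.ABC.Theorems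

/-! ## §1. The [RAD] socket at the genuine `K`-datum with the chosen realising ideles -/

section PerDatum

variable {F K Fbar : Type} [Field F] [NumberField F] [Field K] [NumberField K] [Algebra F K] [Field Fbar]
  [Algebra F Fbar] [Algebra K Fbar] {E : WeierstrassCurve F} [E.IsElliptic] {l : ℕ} {Pb : BadPlacePredicates K}
  (D : InitialThetaData F K Fbar E l Pb) {I : ThetaVolumeInput (fieldOfModuli E) K}
  (M : Type) [Field M] [NumberField M]
  (archPk : ∀ (j : (thetaIndex (pilotDataOfK D K)).Label) (vQ : (thetaIndex (pilotDataOfK D K)).VQ), Set ((logShellsDH (pilotDataOfK D K) (analyticLogv K)).Packet j vQ))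
  (archSub : ∀ (j : (thetaIndex (pilotDataOfK D K)).Label) (v : (thetaIndex (pilotDataOfK D K)).V),
    Set ((logShellsDH (pilotDataOfK D K) (analyticLogv K)).Packet j ((thetaIndex (pilotDataOfK D K)).over v)))
  (Ψ : ℤ → ∀ v : (thetaIndex (pilotDataOfK D K)).V, v ∈ (thetaIndex (pilotDataOfK D K)).Vbad → Set ((logShellsDH (pilotDataOfK D K) (analyticLogv K)).StarPacket v))
  (act : ℤ → ∀ v : (thetaIndex (pilotDataOfK D K)).V, v ∈ (thetaIndex (pilotDataOfK D K)).Vbad →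
    (logShellsDH (pilotDataOfK D K) (analyticLogv K)).StarPacket v → Module.End ℚ ((logShellsDH (pilotDataOfK D K) (analyticLogv K)).StarPacket v))
  (Mmod : ℤ → ∀ j : (thetaIndex (pilotDataOfK D K)).LabelStar, Set ((logShellsDH (pilotDataOfK D K) (analyticLogv K)).GlobalPacket j.1))
  (region : ℤ → ∀ j : (thetaIndex (pilotDataOfK D K)).LabelStar, FinDivisor M → ∀ vQ : (thetaIndex (pilotDataOfK D K)).VQ,
    Set ((logShellsDH (pilotDataOfK D K) (analyticLogv K)).Packet j.1 vQ))
  (frobAdm : ℤ → ℤ → ∀ (j : (thetaIndex (pilotDataOfK D K)).Label) (vQ : (thetaIndex (pilotDataOfK D K)).VQ),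
    Set ((logShellsDH (pilotDataOfK D K) (analyticLogv K)).Packet j vQ) → Prop)
  (frobLogvol : ℤ → ℤ → ∀ (j : (thetaIndex (pilotDataOfK D K)).Label) (vQ : (thetaIndex (pilotDataOfK D K)).VQ),
    Set ((logShellsDH (pilotDataOfK D K) (analyticLogv K)).Packet j vQ) → ℝ)
  (frobΨ : ℤ → ℤ → ∀ v : (thetaIndex (pilotDataOfK D K)).V, v ∈ (thetaIndex (pilotDataOfK D K)).Vbad → Set ((logShellsDH (pilotDataOfK D K) (analyticLogv K)).StarPacket v))
  (frobMmod : ℤ → ℤ → ∀ j : (thetaIndex (pilotDataOfK D K)).LabelStar, Set ((logShellsDH (pilotDataOfK D K) (analyticLogv K)).GlobalPacket j.1))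
  (unitImage : ℤ → ℤ → ℕ → ∀ (j : (thetaIndex (pilotDataOfK D K)).Label) (vQ : (thetaIndex (pilotDataOfK D K)).VQ),
    Set ((logShellsDH (pilotDataOfK D K) (analyticLogv K)).Packet j vQ))
  (ballImage : ℤ → ℤ → ∀ (j : (thetaIndex (pilotDataOfK D K)).Label) (vQ : (thetaIndex (pilotDataOfK D K)).VQ),
    Set ((logShellsDH (pilotDataOfK D K) (analyticLogv K)).Packet j vQ))
  (thetaDiv : ℤ → ℤ → LgpDivisor M (thetaIndex (pilotDataOfK D K)).lstar)
  (n : ℤ) {HT : Type} {LogLink : HT → HT → Type} {IsFull : ∀ {s t : HT}, LogLink s t → Prop}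
  (lat : LGPGaussianLogThetaLattice LogLink IsFull)
  {Frd : Type} {IsoF : Frd → Frd → Type} {Ob : Frd → Type} {realify : Frd → Frd} {Strip : Type}
  {IsoS : Strip → Strip → Type} {Mv : ∀ v : (thetaIndex (pilotDataOfK D K)).V, v ∈ (thetaIndex (pilotDataOfK D K)).Vbad → Type}
  [∀ v h, Monoid (Mv v h)]
  (sig : GlobalLGPFrobenioidSignature (thetaIndex (pilotDataOfK D K)).lstar (thetaIndex (pilotDataOfK D K)).V (· ∈ (thetaIndex (pilotDataOfK D K)).Vbad)
    Frd IsoF Ob realify Strip IsoS Mv)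
  (split : SplittingMonoids Mv) {ObΔ : Type} {N : ∀ v : (thetaIndex (pilotDataOfK D K)).V, v ∈ (thetaIndex (pilotDataOfK D K)).Vbad → Type}
  [∀ v h, Monoid (N v h)] (qData : QPilotData ObΔ N)
  (qK : ∀ v : (thetaIndex (pilotDataOfK D K)).V, v ∈ (thetaIndex (pilotDataOfK D K)).Vbad → Set ((logShellsDH (pilotDataOfK D K) (analyticLogv K)).StarPacket v))

/-- (Private helper; public q-degree form: abc-iut-w5-d236's `GenuineK.not_pilotKummerCompatHull_chosen_of_star_envelope`, p463434.)
**S_H FAILS at the genuine `K`-datum under the STAR × ENVELOPE-RADIUS test** (abc-iut-c312-3's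
`not_licence_settingPrVolSharp_of_explicitDepth_star_envelope`, p454852, at `pilotDataOfK D K` with the CHOSEN realising ideles and the PINNED
reading): for a prime `p`, a label `i₀+1`, a place `x₀ | p` with `‖t_{Θ,i₀+1,x₀}‖ = p^{−m_Θ/e}`, a norm uniformizer `ϖ` of `K_{x₀}`, a turning
point `a₀` of `e = e(K_{x₀}/ℚ_p)` and `‖p^{n₁}‖·‖ϖ‖^{(p^{a₀} − e·a₀)(i₀+2)} < ‖t_{q,x₀}‖`, the hull-level clause
`Cor312Vol.PilotKummerCompatHull … (fun _ => qRegion) qK` is FALSE for every Kummer datum `qK` (the q-pin holds by `rfl`, so the clause IS the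
licence, `licence_of_pilotKummerCompatHull`). Sharp reading; refuted-as-typed only.
[cite: Mochizuki2012, IUTchIII Cor. 3.12 Step (xi-f) p. 184; IUTchIV Prop. 1.2 (i)(ii) p. 10] [cite: NeukirchANT1999, Ch. II (5.5)]
[claim: Mochizuki2012, status: disputed] -/
private theorem HexRad.not_pilotKummerCompatHull_chosen_of_envelope_socket (pp : Nat.Primes)
    (i₀ : Fin (thetaIndex (pilotDataOfK D K)).lstar) (x₀ : (thetaIndex (pilotDataOfK D K)).Fibre (.inr pp)) (mΘ : ℤ)
    (hΘ : haveI : Fact (pp : ℕ).Prime := ⟨pp.2⟩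
      ‖(exists_realising_thetaIdeles_pilotDataOfK D).choose pp i₀ x₀‖ =
        ((pp : ℕ) : ℝ) ^ (-((mΘ : ℝ) / absRamificationIdx (pp : ℕ) (kOf (pilotDataOfK D K) pp.1 x₀))))
    (ϖ : haveI : Fact (pp : ℕ).Prime := ⟨pp.2⟩; (kOf (pilotDataOfK D K) pp.1 x₀)ˣ)
    (hϖ : haveI : Fact (pp : ℕ).Prime := ⟨pp.2⟩; IsUniformizer ϖ) (a₀ : ℕ)
    (hlo : haveI : Fact (pp : ℕ).Prime := ⟨pp.2⟩
      ∀ a < a₀, ((pp : ℕ) : ℤ) ^ a * (((pp : ℕ) : ℤ) - 1) < absRamificationIdx (pp : ℕ) (kOf (pilotDataOfK D K) pp.1 x₀))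
    (hhi : haveI : Fact (pp : ℕ).Prime := ⟨pp.2⟩
      (absRamificationIdx (pp : ℕ) (kOf (pilotDataOfK D K) pp.1 x₀) : ℤ) ≤ ((pp : ℕ) : ℤ) ^ a₀ * (((pp : ℕ) : ℤ) - 1))
    (hdeep : haveI : Fact (pp : ℕ).Prime := ⟨pp.2⟩
      ‖((pp : ℕ) : ℚ_[pp]) ^
          ⌊(mΘ : ℝ) / absRamificationIdx (pp : ℕ) (kOf (pilotDataOfK D K) pp.1 x₀)
            - (dSum (pp : ℕ) ((presAt (pilotDataOfK D K) (logvAnalytic_analyticLogv (F := K)) pp).kk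
                  (fun _ : (thetaIndex (pilotDataOfK D K)).Caps (Setting.labelSucc i₀) => x₀))
                - differentOrd (pp : ℕ) (kOf (pilotDataOfK D K) pp.1 x₀))
            - aSum (pp : ℕ) ((presAt (pilotDataOfK D K) (logvAnalytic_analyticLogv (F := K)) pp).kk
                  (fun _ : (thetaIndex (pilotDataOfK D K)).Caps (Setting.labelSucc i₀) => x₀))⌋‖ *
        (‖(ϖ : kOf (pilotDataOfK D K) pp.1 x₀)‖ ^
            (((pp : ℕ) : ℤ) ^ a₀ - (absRamificationIdx (pp : ℕ) (kOf (pilotDataOfK D K) pp.1 x₀) : ℤ) * (a₀ : ℤ))) ^ ((i₀ : ℕ) + 2)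
          < ‖(exists_realising_qIdeles_pilotDataOfK D).choose pp x₀‖) :
    ¬ Cor312Vol.PilotKummerCompatHull
        (LatticeSituation.ofShells (logShellsDH (pilotDataOfK D K) (analyticLogv K)) M archPk archSub
        (summandPiecesPr (pilotDataOfK D K) (logvAnalytic_analyticLogv (F := K))).Adm
        (summandPiecesPr (pilotDataOfK D K) (logvAnalytic_analyticLogv (F := K))).logvol Ψ act Mmod region frobAdm frobLogvol frobΨ
        frobMmod unitImage ballImage thetaDiv)
        (settingPrVolSharp (pilotDataOfK D K) (logvAnalytic_analyticLogv (F := K)) M archPk archSub Ψ act Mmod region n lat sig split qData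
        (exists_realising_qIdeles_pilotDataOfK D).choose (exists_realising_thetaIdeles_pilotDataOfK D).choose
        (exists_realising_qIdeles_pilotDataOfK D).choose_spec.1 (exists_realising_qIdeles_pilotDataOfK D).choose_spec.2.1)
        (fun _ => Cor312.Setting.qRegion
        (settingPrVolSharp (pilotDataOfK D K) (logvAnalytic_analyticLogv (F := K)) M archPk archSub Ψ act Mmod region n lat sig split qData
        (exists_realising_qIdeles_pilotDataOfK D).choose (exists_realising_thetaIdeles_pilotDataOfK D).choose
        (exists_realising_qIdeles_pilotDataOfK D).choose_spec.1 (exists_realising_qIdeles_pilotDataOfK D).choose_spec.2.1)) qK := fun hSH =>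
  not_licence_settingPrVolSharp_of_explicitDepth_star_envelope (pilotDataOfK D K) (logvAnalytic_analyticLogv (F := K)) M archPk
    archSub Ψ act Mmod region n lat sig split qData (exists_realising_qIdeles_pilotDataOfK D).choose
    (exists_realising_thetaIdeles_pilotDataOfK D).choose (exists_realising_qIdeles_pilotDataOfK D).choose_spec.1
    (exists_realising_qIdeles_pilotDataOfK D).choose_spec.2.1 pp i₀ x₀ mΘ hΘ ϖ hϖ a₀ hlo hhi hdeep
    (licence_of_pilotKummerCompatHull
      (LatticeSituation.ofShells (logShellsDH (pilotDataOfK D K) (analyticLogv K)) M archPk archSub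
          (summandPiecesPr (pilotDataOfK D K) (logvAnalytic_analyticLogv (F := K))).Adm
          (summandPiecesPr (pilotDataOfK D K) (logvAnalytic_analyticLogv (F := K))).logvol Ψ act Mmod region frobAdm frobLogvol frobΨ
          frobMmod unitImage ballImage thetaDiv)
      _ _ qK (fun _ _ => rfl) hSH)

end PerDatum

/-! ## §2. HEX: the `λ_k` datum under a local ramification bound and W-num-6's RAD-UNIFORM criterion -/

/-- **HEX-RAD: S_H FAILS at every datum over `(λ_k, l)` under a local ramification bound and ONE integer criterion.** Let `k ≥ 1`, `l ≥ 11`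
prime, `j = (l−1)/2`; let every place `x₀ | 7` of the datum have `e(K_{x₀}/ℚ_7) ≤ E`, let `S` be a turning index of `E`
(`7^a·6 < E` for `a < S`, `E ≤ 7^S·6`), `F` an integer with `5l·F ≤ 5j²k − 5jl − (j+1)(l+5)`, and assume W-num-6's criterion
`(j+1)·l·(S·E − 7^S) < (F·l − k)·E`. Then at EVERY genuine Θ-volume datum `T` over `(ratPoint λ_k, l)`, for EVERY choice of the free context
binders and Kummer data, the hull-level clause S_H at the sharp genuine K-setting (CHOSEN realising ideles, PINNED reading) is FALSE: the
top label over `7` (`x₀` bad, tame, `‖t_q(x₀)‖ = 7^{−k/l}`, `l ∣ e ≤ E`) passes the STAR × ENVELOPE test of §1 by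
`HexRad.logExponent_lt_floor_of_criterion`. [cite: Mochizuki2012, IUTchIII Cor. 3.12 Step (xi-f) p. 184; IUTchIV Prop. 1.2 (i)(ii) p. 10,
Cor. 2.2 (ii) proof (P5) p. 46] [cite: NeukirchANT1999, Ch. II (5.5)] [claim: Mochizuki2012, status: disputed] -/
theorem HexRad.not_pilotKummerCompatHull_lamSeven_of_criterion {k l E S : ℕ} {F : ℤ} (hk : 1 ≤ k) (hl : l.Prime) (h11 : 11 ≤ l)
    (hloS : ∀ a < S, (7 : ℤ) ^ a * ((7 : ℤ) - 1) < E) (hhiS : (E : ℤ) ≤ (7 : ℤ) ^ S * ((7 : ℤ) - 1))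
    (hF : 5 * (l : ℤ) * F ≤ 5 * ((l - 1) / 2 : ℕ) ^ 2 * k - 5 * ((l - 1) / 2 : ℕ) * l - (((l - 1) / 2 : ℕ) + 1) * (l + 5))
    (hcrit : (((l - 1) / 2 : ℕ) + 1 : ℤ) * l * (S * E - 7 ^ S) < (F * l - k) * E)
    (T : Cor22.ThetaVolumeDatumAt (ratPoint ((2 : ℚ)⁻¹ + 2 / 7 ^ k)) l)
    (hloc : letI := T.instFieldF; letI := T.instNumberFieldF; letI := T.instAlgebraF; letI := T.instFieldK
      letI := T.instNumberFieldK; letI := T.instAlgebraK; letI := T.instFieldFbar; letI := T.instAlgebraFbar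
      letI := T.instAlgebraKFbar; letI := T.instIsElliptic
      haveI : Fact (Nat.Prime 7) := ⟨by norm_num⟩
      ∀ x₀ : (thetaIndex (pilotDataOfK T.D T.K)).Fibre (.inr ⟨7, by norm_num⟩),
        absRamificationIdx 7 (kOf (pilotDataOfK T.D T.K) 7 x₀) ≤ E) :
    letI := T.instFieldF; letI := T.instNumberFieldF; letI := T.instAlgebraF; letI := T.instFieldK
    letI := T.instNumberFieldK; letI := T.instAlgebraK; letI := T.instFieldFbar; letI := T.instAlgebraFbar
    letI := T.instAlgebraKFbar; letI := T.instIsElliptic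
    ∀ (M : Type) [Field M] [NumberField M]
      (archPk : ∀ (j : (thetaIndex (pilotDataOfK T.D T.K)).Label) (vQ : (thetaIndex (pilotDataOfK T.D T.K)).VQ),
        Set ((logShellsDH (pilotDataOfK T.D T.K) (analyticLogv T.K)).Packet j vQ))
      (archSub : ∀ (j : (thetaIndex (pilotDataOfK T.D T.K)).Label) (v : (thetaIndex (pilotDataOfK T.D T.K)).V),
        Set ((logShellsDH (pilotDataOfK T.D T.K) (analyticLogv T.K)).Packet j ((thetaIndex (pilotDataOfK T.D T.K)).over v)))
      (Ψ : ℤ → ∀ v : (thetaIndex (pilotDataOfK T.D T.K)).V, v ∈ (thetaIndex (pilotDataOfK T.D T.K)).Vbad →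
        Set ((logShellsDH (pilotDataOfK T.D T.K) (analyticLogv T.K)).StarPacket v))
      (act : ℤ → ∀ v : (thetaIndex (pilotDataOfK T.D T.K)).V, v ∈ (thetaIndex (pilotDataOfK T.D T.K)).Vbad →
        (logShellsDH (pilotDataOfK T.D T.K) (analyticLogv T.K)).StarPacket v →
          Module.End ℚ ((logShellsDH (pilotDataOfK T.D T.K) (analyticLogv T.K)).StarPacket v))
      (Mmod : ℤ → ∀ j : (thetaIndex (pilotDataOfK T.D T.K)).LabelStar,
        Set ((logShellsDH (pilotDataOfK T.D T.K) (analyticLogv T.K)).GlobalPacket j.1))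
      (region : ℤ → ∀ j : (thetaIndex (pilotDataOfK T.D T.K)).LabelStar, FinDivisor M →
        ∀ vQ : (thetaIndex (pilotDataOfK T.D T.K)).VQ, Set ((logShellsDH (pilotDataOfK T.D T.K) (analyticLogv T.K)).Packet j.1 vQ))
      (frobAdm : ℤ → ℤ → ∀ (j : (thetaIndex (pilotDataOfK T.D T.K)).Label) (vQ : (thetaIndex (pilotDataOfK T.D T.K)).VQ),
        Set ((logShellsDH (pilotDataOfK T.D T.K) (analyticLogv T.K)).Packet j vQ) → Prop)
      (frobLogvol : ℤ → ℤ → ∀ (j : (thetaIndex (pilotDataOfK T.D T.K)).Label) (vQ : (thetaIndex (pilotDataOfK T.D T.K)).VQ),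
        Set ((logShellsDH (pilotDataOfK T.D T.K) (analyticLogv T.K)).Packet j vQ) → ℝ)
      (frobΨ : ℤ → ℤ → ∀ v : (thetaIndex (pilotDataOfK T.D T.K)).V, v ∈ (thetaIndex (pilotDataOfK T.D T.K)).Vbad →
        Set ((logShellsDH (pilotDataOfK T.D T.K) (analyticLogv T.K)).StarPacket v))
      (frobMmod : ℤ → ℤ → ∀ j : (thetaIndex (pilotDataOfK T.D T.K)).LabelStar,
        Set ((logShellsDH (pilotDataOfK T.D T.K) (analyticLogv T.K)).GlobalPacket j.1))
      (unitImage : ℤ → ℤ → ℕ → ∀ (j : (thetaIndex (pilotDataOfK T.D T.K)).Label) (vQ : (thetaIndex (pilotDataOfK T.D T.K)).VQ),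
        Set ((logShellsDH (pilotDataOfK T.D T.K) (analyticLogv T.K)).Packet j vQ))
      (ballImage : ℤ → ℤ → ∀ (j : (thetaIndex (pilotDataOfK T.D T.K)).Label) (vQ : (thetaIndex (pilotDataOfK T.D T.K)).VQ),
        Set ((logShellsDH (pilotDataOfK T.D T.K) (analyticLogv T.K)).Packet j vQ))
      (thetaDiv : ℤ → ℤ → LgpDivisor M (thetaIndex (pilotDataOfK T.D T.K)).lstar)
      (n : ℤ) {HT : Type} {LogLink : HT → HT → Type} {IsFull : ∀ {s t : HT}, LogLink s t → Prop}
      (lat : LGPGaussianLogThetaLattice LogLink IsFull)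
      {Frd : Type} {IsoF : Frd → Frd → Type} {Ob : Frd → Type} {realify : Frd → Frd} {Strip : Type}
      {IsoS : Strip → Strip → Type} {Mv : ∀ v : (thetaIndex (pilotDataOfK T.D T.K)).V, v ∈ (thetaIndex (pilotDataOfK T.D T.K)).Vbad → Type}
      [∀ v h, Monoid (Mv v h)]
      (sig : GlobalLGPFrobenioidSignature (thetaIndex (pilotDataOfK T.D T.K)).lstar (thetaIndex (pilotDataOfK T.D T.K)).V
        (· ∈ (thetaIndex (pilotDataOfK T.D T.K)).Vbad) Frd IsoF Ob realify Strip IsoS Mv)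
      (split : SplittingMonoids Mv) {ObΔ : Type}
      {N : ∀ v : (thetaIndex (pilotDataOfK T.D T.K)).V, v ∈ (thetaIndex (pilotDataOfK T.D T.K)).Vbad → Type}
      [∀ v h, Monoid (N v h)] (qData : QPilotData ObΔ N)
      (qK : ∀ v : (thetaIndex (pilotDataOfK T.D T.K)).V, v ∈ (thetaIndex (pilotDataOfK T.D T.K)).Vbad →
        Set ((logShellsDH (pilotDataOfK T.D T.K) (analyticLogv T.K)).StarPacket v)),
    ¬ Cor312Vol.PilotKummerCompatHull
        (LatticeSituation.ofShells (logShellsDH (pilotDataOfK T.D T.K) (analyticLogv T.K)) M archPk archSub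
          (summandPiecesPr (pilotDataOfK T.D T.K) (logvAnalytic_analyticLogv (F := T.K))).Adm
          (summandPiecesPr (pilotDataOfK T.D T.K) (logvAnalytic_analyticLogv (F := T.K))).logvol Ψ act Mmod region frobAdm
          frobLogvol frobΨ frobMmod unitImage ballImage thetaDiv)
        (settingPrVolSharp (pilotDataOfK T.D T.K) (logvAnalytic_analyticLogv (F := T.K)) M archPk archSub Ψ act Mmod region n
          lat sig split qData (exists_realising_qIdeles_pilotDataOfK T.D).choose (exists_realising_thetaIdeles_pilotDataOfK T.D).choose
          (exists_realising_qIdeles_pilotDataOfK T.D).choose_spec.1 (exists_realising_qIdeles_pilotDataOfK T.D).choose_spec.2.1)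
        (fun _ => Cor312.Setting.qRegion
          (settingPrVolSharp (pilotDataOfK T.D T.K) (logvAnalytic_analyticLogv (F := T.K)) M archPk archSub Ψ act Mmod region n
            lat sig split qData (exists_realising_qIdeles_pilotDataOfK T.D).choose (exists_realising_thetaIdeles_pilotDataOfK T.D).choose
            (exists_realising_qIdeles_pilotDataOfK T.D).choose_spec.1 (exists_realising_qIdeles_pilotDataOfK T.D).choose_spec.2.1))
        qK := by
  classical
  letI := T.instFieldF; letI := T.instNumberFieldF; letI := T.instAlgebraF; letI := T.instFieldK
  letI := T.instNumberFieldK; letI := T.instAlgebraK; letI := T.instFieldFbar; letI := T.instAlgebraFbar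
  letI := T.instAlgebraKFbar; letI := T.instIsElliptic
  intro M _ _ archPk archSub Ψ act Mmod region frobAdm frobLogvol frobΨ frobMmod
    unitImage ballImage thetaDiv n' HT LogLink IsFull lat Frd IsoF Ob realify Strip IsoS Mv _ sig split ObΔ N _ qData qK
  haveI : Fact (Nat.Prime 7) := ⟨by norm_num⟩
  obtain ⟨x₀, hS, htame, -, -, hnorm⟩ := GenuineK.exists_place_lamSeven hk hl h11 T
  -- abbreviations
  set e : ℕ := absRamificationIdx 7 (kOf (pilotDataOfK T.D T.K) 7 x₀) with he_def
  have hepos : 0 < e := absRamificationIdx_pos _ _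
  have he0 : (0 : ℝ) < e := by exact_mod_cast hepos
  have hle : l ≤ e := l_le_absRamificationIdx_kOf_pilotDataOfK T.D ⟨7, by norm_num⟩ x₀ hS
  have heE : e ≤ E := hloc x₀
  -- `l ∣ e` (every bad place of `K` has `l ∣ e(w|v) ∣ e(w|7)`)
  have hdvd : l ∣ e := by
    have hw := (mem_pilotDataOfK_S_iff T.D T.K (placeOf (pilotDataOfK T.D T.K) 7 x₀)).mp hS
    have h1 := l_dvd_absRamificationIdx_of_under_mem_VFbad T.D hw
    rwa [he_def, show absRamificationIdx 7 (kOf (pilotDataOfK T.D T.K) 7 x₀) =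
        absRamificationIdx 7 (RescaledCompletion T.K 7 (placeOf (pilotDataOfK T.D T.K) 7 x₀) (natCast_mem_placeOf (pilotDataOfK T.D T.K) 7 x₀)) from rfl,
      absRamificationIdx_rescaledCompletion]
  obtain ⟨e', he'⟩ := hdvd
  have he'R : (e : ℝ) = (l : ℝ) * e' := by exact_mod_cast he'
  have hl0 : (0 : ℝ) < l := by exact_mod_cast hl.pos
  -- the top label `i₀ = j − 1`, `j = (l−1)/2`
  set j : ℕ := (l - 1) / 2 with hj
  have hj5 : 5 ≤ j := by omega
  have hlstar : (thetaIndex (pilotDataOfK T.D T.K)).lstar = (l - 1) / 2 := rfl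
  have hil : j - 1 < (thetaIndex (pilotDataOfK T.D T.K)).lstar := by rw [hlstar]; omega
  set i₀ : Fin (thetaIndex (pilotDataOfK T.D T.K)).lstar := ⟨j - 1, hil⟩ with hi₀def
  have hi₀ : (i₀ : ℕ) = j - 1 := rfl
  have hi₀1 : (i₀ : ℕ) + 1 = j := by rw [hi₀]; omega
  have hi₀2 : ((i₀ : ℕ) : ℝ) + 2 = (j : ℝ) + 1 := by
    have : (((i₀ : ℕ) + 1 : ℕ) : ℝ) = j := by exact_mod_cast hi₀1
    push_cast at this; linarith
  -- turning point of `e`, a norm uniformizer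
  obtain ⟨a₀, hlo, hhi⟩ := exists_turning (p := 7) e
  set ϖ := unifChoice (kOf (pilotDataOfK T.D T.K) 7 x₀) with hϖdef
  have hϖ : IsUniformizer ϖ := isUniformizer_unifChoice (kOf (pilotDataOfK T.D T.K) 7 x₀)
  -- the Θ-order `m_Θ = j²·k·(e/l)` and the norm of the chosen Θ-idele
  set mΘ : ℤ := ((j ^ 2 * k * e' : ℕ) : ℤ) with hmΘ
  have hmΘe : (mΘ : ℝ) / e = (j : ℝ) ^ 2 * k / l := by
    rw [hmΘ, he'R]
    have he'0 : (0 : ℝ) < e' := by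
      rcases Nat.eq_zero_or_pos e' with h0 | h0
      · exfalso; rw [h0, mul_zero] at he'; omega
      · exact_mod_cast h0
    push_cast
    field_simp
  have hΘ : ‖(exists_realising_thetaIdeles_pilotDataOfK T.D).choose ⟨7, by norm_num⟩ i₀ x₀‖ =
      ((7 : ℕ) : ℝ) ^ (-((mΘ : ℝ) / absRamificationIdx 7 (kOf (pilotDataOfK T.D T.K) 7 x₀))) := by
    rw [norm_thetaIdele_eq_pow_of_realises (pilotDataOfK T.D T.K) (exists_realising_thetaIdeles_pilotDataOfK T.D).choose
      (exists_realising_thetaIdeles_pilotDataOfK T.D).choose_spec.1 (exists_realising_thetaIdeles_pilotDataOfK T.D).choose_spec.2.2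
      (exists_realising_qIdeles_pilotDataOfK T.D).choose (exists_realising_qIdeles_pilotDataOfK T.D).choose_spec.1
      (exists_realising_qIdeles_pilotDataOfK T.D).choose_spec.2.2 ⟨7, by norm_num⟩ i₀ x₀, hnorm, hi₀1, ← he_def, hmΘe,
      ← Real.rpow_natCast, ← Real.rpow_mul (by norm_num)]
    push_cast
    congr 1
    ring
  -- the different exponent is `< 1` (tame place)
  have hd : differentOrd 7 (kOf (pilotDataOfK T.D T.K) 7 x₀) < 1 := by
    rw [differentOrd_eq_of_not_dvd 7 (kOf (pilotDataOfK T.D T.K) 7 x₀) htame, ← he_def, div_lt_one he0]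
    linarith
  -- W-num-6's core in log form
  have hlo' : ∀ a < a₀, (7 : ℤ) ^ a * ((7 : ℤ) - 1) < e := fun a ha => by simpa using hlo a ha
  have hhi' : (e : ℤ) ≤ (7 : ℤ) ^ a₀ * ((7 : ℤ) - 1) := by simpa using hhi
  have hcore := HexRad.logExponent_lt_floor_of_criterion k l e E a₀ S F (differentOrd 7 (kOf (pilotDataOfK T.D T.K) 7 x₀)) h11 hle heE hd
    hlo' hhi' hloS hhiS hF hcrit
  -- §1 at this packet
  refine HexRad.not_pilotKummerCompatHull_chosen_of_envelope_socket T.D M archPk archSub Ψ act Mmod region frobAdm frobLogvol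
    frobΨ frobMmod unitImage ballImage thetaDiv n' lat sig split qData qK ⟨7, by norm_num⟩ i₀ x₀ mΘ hΘ ϖ hϖ a₀
    (fun a ha => by simpa using hlo a ha) (by simpa using hhi) ?_
  -- the depth test: `‖7^{n₁}‖·‖ϖ‖^{(7^{a₀} − e·a₀)(j+1)} < ‖t_q(x₀)‖ = 7^{−k/l}`
  -- (a) the constant-tuple sums
  have hcard : (Fintype.card ((thetaIndex (pilotDataOfK T.D T.K)).Caps (Setting.labelSucc i₀)) : ℝ) = (j : ℝ) + 1 := by
    rw [show Fintype.card ((thetaIndex (pilotDataOfK T.D T.K)).Caps (Setting.labelSucc i₀)) = (Setting.labelSucc (T := thetaIndex (pilotDataOfK T.D T.K)) i₀ : ℕ) + 1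
      from Fintype.card_fin _, Setting.labelSucc, Fin.val_succ]
    push_cast
    linarith
  have hd0 : dSum 7 ((presAt (pilotDataOfK T.D T.K) (logvAnalytic_analyticLogv (F := T.K)) ⟨7, by norm_num⟩).kk
      (fun _ : (thetaIndex (pilotDataOfK T.D T.K)).Caps (Setting.labelSucc i₀) => x₀)) = ((j : ℝ) + 1) * differentOrd 7 (kOf (pilotDataOfK T.D T.K) 7 x₀) := by
    show ∑ _a : (thetaIndex (pilotDataOfK T.D T.K)).Caps (Setting.labelSucc i₀), differentOrd 7 (kOf (pilotDataOfK T.D T.K) 7 x₀) = _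
    rw [Finset.sum_const, Finset.card_univ, nsmul_eq_mul, hcard]
  have ha0 : aSum 7 ((presAt (pilotDataOfK T.D T.K) (logvAnalytic_analyticLogv (F := T.K)) ⟨7, by norm_num⟩).kk
      (fun _ : (thetaIndex (pilotDataOfK T.D T.K)).Caps (Setting.labelSucc i₀) => x₀)) = ((j : ℝ) + 1) * logRadiusA 7 e := by
    show ∑ _a : (thetaIndex (pilotDataOfK T.D T.K)).Caps (Setting.labelSucc i₀), logRadiusA 7 (absRamificationIdx 7 (kOf (pilotDataOfK T.D T.K) 7 x₀)) = _
    rw [Finset.sum_const, Finset.card_univ, nsmul_eq_mul, hcard]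
  -- (b) the floor exponent `n₁` is the core's
  have hn₁ : ⌊(mΘ : ℝ) / absRamificationIdx 7 (kOf (pilotDataOfK T.D T.K) 7 x₀)
        - (dSum 7 ((presAt (pilotDataOfK T.D T.K) (logvAnalytic_analyticLogv (F := T.K)) ⟨7, by norm_num⟩).kk
              (fun _ : (thetaIndex (pilotDataOfK T.D T.K)).Caps (Setting.labelSucc i₀) => x₀)) - differentOrd 7 (kOf (pilotDataOfK T.D T.K) 7 x₀))
        - aSum 7 ((presAt (pilotDataOfK T.D T.K) (logvAnalytic_analyticLogv (F := T.K)) ⟨7, by norm_num⟩).kk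
              (fun _ : (thetaIndex (pilotDataOfK T.D T.K)).Caps (Setting.labelSucc i₀) => x₀))⌋ =
      ⌊((j : ℕ) : ℝ) ^ 2 * k / l - ((j : ℕ) : ℝ) * differentOrd 7 (kOf (pilotDataOfK T.D T.K) 7 x₀) - (((j : ℕ) : ℝ) + 1) * logRadiusA 7 e⌋ := by
    rw [hd0, ha0, ← he_def, hmΘe]
    congr 1
    ring
  -- (c) norms to exponents
  have h7 : (1 : ℝ) < 7 := by norm_num
  have h70 : (0 : ℝ) < 7 := by norm_num
  have hnp : ∀ z : ℤ, ‖((7 : ℕ) : ℚ_[7]) ^ z‖ = (7 : ℝ) ^ ((-z : ℤ) : ℝ) := fun z => by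
    rw [Padic.norm_p_zpow, ← Real.rpow_intCast]; norm_num
  have hϖn : ‖(ϖ : kOf (pilotDataOfK T.D T.K) 7 x₀)‖ = (7 : ℝ) ^ (-(1 / (e : ℝ))) := by
    rw [he_def]; exact_mod_cast norm_eq_rpow_of_isUniformizer 7 (kOf (pilotDataOfK T.D T.K) 7 x₀) hϖ
  have hϖpow : (‖(ϖ : kOf (pilotDataOfK T.D T.K) 7 x₀)‖ ^ ((7 : ℤ) ^ a₀ - (e : ℤ) * (a₀ : ℤ))) ^ ((i₀ : ℕ) + 2) =
      (7 : ℝ) ^ (-(((7 : ℝ) ^ a₀ - e * a₀) / e) * (((i₀ : ℕ) : ℝ) + 2)) := by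
    rw [hϖn, ← Real.rpow_intCast, ← Real.rpow_mul h70.le, ← Real.rpow_natCast, ← Real.rpow_mul h70.le]
    congr 1
    push_cast
    field_simp
  rw [hn₁]
  show ‖((7 : ℕ) : ℚ_[7]) ^ ⌊((j : ℕ) : ℝ) ^ 2 * k / l - ((j : ℕ) : ℝ) * differentOrd 7 (kOf (pilotDataOfK T.D T.K) 7 x₀)
        - (((j : ℕ) : ℝ) + 1) * logRadiusA 7 e⌋‖ *
      (‖(ϖ : kOf (pilotDataOfK T.D T.K) 7 x₀)‖ ^ ((7 : ℤ) ^ a₀ - (e : ℤ) * (a₀ : ℤ))) ^ ((i₀ : ℕ) + 2) <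
      ‖(exists_realising_qIdeles_pilotDataOfK T.D).choose ⟨7, by norm_num⟩ x₀‖
  rw [hnp, hϖpow, hnorm, ← Real.rpow_add h70, Real.rpow_lt_rpow_left_iff h7, hi₀2]
  -- (d) the exponent inequality is the core
  have hee : ((7 : ℝ) ^ a₀ - e * a₀) / e = (7 : ℝ) ^ a₀ / e - a₀ := by field_simp
  rw [hee]
  push_cast at hcore ⊢
  linarith

end Summit.ABC.IUTFork.Conditional

end
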